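import Mathlib.FieldTheory.IsAlgClosed.AlgebraicClosure
import Literature.Computability.AlgebraicComplexity.MatMulRankLowerBoundsProofs
import HarnessLib

/-!
# Bläser's `5/2 n² − 3n` lower bound for the rank of `n × n` matrix multiplication (proofs)

Topic: `Literature/Computability/AlgebraicComplexity`. Second sibling proof file of
`MatMulRankLowerBounds.lean`: it discharges the named fact
`Literature.Computability.AlgebraicComplexity.Blaser1999_rank_lower_bound` — over an arbitrary
field `K`, `R(⟨n,n,n⟩) ≥ (5/2) n² − 3n` (Bläser, FOCS 1999, Thm 2) — as
`Blaser1999_rank_lower_bound_holds`, sorry-free.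

## Content

* `tensorRank_map_le`, `matMulTensor_map`, `tensorRank_matMulTensor_map_le` — extension of scalars
  along a ring homomorphism `K → L` does not increase the rank, and `⟨k,m,n⟩` is defined over the
  prime ring, so `R_L(⟨k,m,n⟩) ≤ R_K(⟨k,m,n⟩)` (Bläser 1999, §5, (10): "`R_K(A ⊗ K) ≤ R_k(A)` …
  hence lower bounds over some ground field hold over all of its subfields").
* `exists_matMulKoszulMatrix_one_injective` — the case `p = 1` of Landsberg's reduced Koszul
  flattening (`MatMulRankLowerBoundsProofs.commutatorProj` uses `X₂ = diag(0,1,…,n−1)` and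
  characteristic `0`) with the diagonal matrix `X₂ = diag(d₀,…,d_{n−1})` for an arbitrary
  injective `d : Fin n → K`, `X₁ =` the cyclic shift, `X₀ = Id`: `M̃(Φ)` is injective over any
  field as soon as the `d_i` are pairwise distinct. This is exactly Bläser's pair
  `a₀ = diag(λ₁,…,λ_n)` (pairwise distinct), `b₀ =` cyclic shift with `[a₀, b₀]` invertible
  (Bläser 1999, §1 p.46 and proof of Lemma 6).
* `Landsberg2014_prop_2_1_koszul_field` — `Landsberg2014_prop_2_1_koszul` (Landsberg 2014,
  Prop 2.1 + Lemma 2.2 + §3) verbatim over an arbitrary **infinite** field instead of `ℂ` (the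
  proof in `MatMulRankLowerBoundsProofs` uses `ℂ` only through `Infinite ℂ`).
* `Blaser1999_rank_lower_bound_of_infinite` — the bound over an infinite field;
  `Blaser1999_rank_lower_bound_holds : Blaser1999_rank_lower_bound` — over every field, by base
  change to the algebraic closure.

## On the printed proof

Bläser's proof (FOCS 1999, pp. 45–50): Lemma 3 (for a bilinear computation of an algebra `A` with
`1, a, b ∈ ⋂_{ρ ≤ m} ker f_ρ`, `r ≥ m + N + ½ dim([a,b]A)`), sandwiching (§3), Lemma 5 (over an
infinite field a span containing an invertible matrix contains one in the span of `≤ n` of the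
generators — the monomial-of-a-determinant argument), Lemma 6 (Lie theory: `t ≤ 2n` basis elements
span `a, b` with `[a, b]` invertible), and §5: by (10) one may assume `k` infinite, then Lemma 3
with `m = N − 3n` gives `2N − 3n + n²/2`.  The route formalised here keeps Bläser's reduction (10)
to an infinite field and his choice of `diag(λ_i)`/cyclic shift, but replaces Lemma 3 + Lemmas 5–6
by the `p = 1` case of Landsberg's Koszul-flattening argument (Landsberg 2014, §4), already proved
in `MatMulRankLowerBoundsProofs` and valid over any infinite field: it yields the same number
`(3 − 1/2) n² − (1 + 2·binom(2,0)) n = (5/2) n² − 3n`.  The statement discharged is exactly the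
vendored `Blaser1999_rank_lower_bound` (all fields, all `n`; for `n ≤ 1` the bound is below the
flattening bound `n² ≤ R`).  Bläser's Lemma 3 itself is not formalised here.

## References

* M. Bläser, *A 5/2 n²-lower bound for the rank of n×n-matrix multiplication over arbitrary
  fields*, FOCS 1999, 45–50, doi:10.1109/SFFCS.1999.814576: Thm 2 (p.45, proof p.49), §1 p.46
  (`a₀ = diag`, `b₀ =` cyclic shift), Lemma 3, Lemmas 5–6, §5 eq. (10). [Blaser1999]
* J. M. Landsberg, *New lower bounds for the rank of matrix multiplication*, SIAM J. Comput. 43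
  (2014) 144–149: Prop 2.1, Lemma 2.2, §3, §4 (case `p = 1`). [Landsberg2014]
-/

noncomputable section

open scoped BigOperators
open Matrix

namespace Literature.Computability.AlgebraicComplexity

/-! ## Base change: Bläser 1999, §5, (10) -/

section BaseChange

variable {K L : Type*} [CommSemiring K] [CommSemiring L] {ι κ μ : Type*}

/-- Extension of scalars along a ring homomorphism `f : K → L` does not increase the rank:
applying `f` to a decomposition into `R(t)` triads gives a decomposition of `f ∘ t`
(Bläser 1999, §5, proof of (10)). [cite: Blaser1999, §5 eq. (10)] -/
theorem tensorRank_map_le [Fintype ι] [Fintype κ] [Fintype μ] (f : K →+* L)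
    (t : ι → κ → μ → K) : tensorRank (fun a b c => f (t a b c)) ≤ tensorRank t := by
  obtain ⟨w, u, v, ht⟩ := exists_triad_decomposition_tensorRank t
  refine tensorRank_le_of_eq_sum (fun i => ⇑f ∘ w i) (fun i => ⇑f ∘ u i) (fun i => ⇑f ∘ v i) ?_
  funext a b c
  have h := congrFun (congrFun (congrFun ht a) b) c
  rw [h]
  simp [Finset.sum_apply, triad_apply, map_sum, map_mul]

/-- The matrix multiplication tensor has entries `0, 1`, so its image under any ring homomorphism
`K → L` is the matrix multiplication tensor over `L` (`M_n(k) ⊗ K = M_n(K)`, Bläser 1999, §5).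
[cite: Blaser1999, §5 eq. (10)] -/
theorem matMulTensor_map (f : K →+* L) (k m n : ℕ) :
    (fun a b c => f (matMulTensor K k m n a b c)) = matMulTensor L k m n := by
  funext a b c
  simp only [matMulTensor]
  split_ifs <;> simp

/-- **Bläser 1999, §5, (10)** for matrix multiplication: along any ring homomorphism `K → L`
(in particular for a field extension `L ⊇ K`), `R_L(⟨k,m,n⟩) ≤ R_K(⟨k,m,n⟩)` — "lower bounds over
some ground field hold over all of its subfields". [cite: Blaser1999, §5 eq. (10)] -/
theorem tensorRank_matMulTensor_map_le (f : K →+* L) (k m n : ℕ) :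
    tensorRank (matMulTensor L k m n) ≤ tensorRank (matMulTensor K k m n) := by
  rw [← matMulTensor_map f k m n]
  exact tensorRank_map_le f _

end BaseChange

/-! ## Injectivity of `M̃(Φ)` for `p = 1` over any field -/

section POneField

variable (K : Type*) [Field K]

/-- **Landsberg 2014, §4, case `p = 1`, over an arbitrary field.** For `n ≥ 2` and pairwise
distinct `d₀, …, d_{n−1} ∈ K` there is a projection `Φ : K^{n×n} → K³` whose reduced Koszul
flattening `M̃(Φ) : K³ ⊗ Kⁿ → Λ²K³ ⊗ Kⁿ` (a `3n × 3n` matrix) is injective, namely the one with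
coordinate matrices `X₀ = Id`, `X₁ =` the cyclic shift, `X₂ = diag(d₀, …, d_{n−1})` — Landsberg's
`p = 1` projection (`commutatorProj`, which has `d_i = i` and needs characteristic `0`) with Bläser's
pair `a₀ = diag(λ₁, …, λ_n)` ("pairwise distinct entries in the diagonal"), `b₀ =` cyclic shift, for
which `[a₀, b₀]` is invertible (Bläser 1999, §1, p.46).  The three block rows of `M̃(Φ) z = 0` give
`z₁ = X₁ᵀ z₀`, `z₂ = X₂ᵀ z₀`, `X₂ᵀ z₁ = X₁ᵀ z₂`, whence `(d_{σκ} − d_κ) (z₀)_κ = 0` and `z = 0`; the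
same computation as `matMulKoszulMatrix_commutatorProj_injective` with the injectivity of
`Nat.cast` replaced by that of `d`. [cite: Landsberg2014, §4 (case p = 1)] -/
theorem exists_matMulKoszulMatrix_one_injective (n : ℕ) (hn : 2 ≤ n) (d : Fin n → K)
    (hd : Function.Injective d) :
    ∃ Φ : (Fin n × Fin n → K) →ₗ[K] (Fin (2 * 1 + 1) → K),
      Function.Injective (matMulKoszulMatrix n 1 Φ).mulVec := by
  classical
  -- the `3 × n²` matrix of the projection: rows `X₀ = Id`, `X₁ =` cyclic shift, `X₂ = diag(d)`
  set X : Matrix (Fin (2 * 1 + 1)) (Fin n × Fin n) K := Matrix.of fun j a =>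
    if j = 0 then (if a.1 = a.2 then 1 else 0)
    else if j = 1 then (if finRotate n a.1 = a.2 then 1 else 0)
    else (if a.1 = a.2 then d a.1 else 0) with hX
  refine ⟨X.mulVecLin, ?_⟩
  set M := matMulKoszulMatrix n 1 X.mulVecLin
  have hsingle : ∀ (κ ν : Fin n) (j : Fin (2 * 1 + 1)),
      X.mulVecLin (Pi.single (κ, ν) 1) j = X j (κ, ν) := by
    intro κ ν j
    simp
  have sum0 : ∀ (ν : Fin n) (f : Fin n → K), ∑ κ, X 0 (κ, ν) * f κ = f ν := by
    intro ν f
    simp [hX, ite_mul]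
  have sum1 : ∀ (ν : Fin n) (f : Fin n → K),
      ∑ κ, X 1 (κ, ν) * f κ = f ((finRotate n).symm ν) := by
    intro ν f
    have h : (1 : Fin (2 * 1 + 1)) ≠ 0 := by decide
    simp only [hX, Matrix.of_apply, if_neg h, if_true, ite_mul, one_mul, zero_mul]
    simp_rw [Equiv.apply_eq_iff_eq_symm_apply (finRotate n)]
    simp
  have sum2 : ∀ (ν : Fin n) (f : Fin n → K), ∑ κ, X 2 (κ, ν) * f κ = d ν * f ν := by
    intro ν f
    have h : (2 : Fin (2 * 1 + 1)) ≠ 0 := by decide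
    have h' : (2 : Fin (2 * 1 + 1)) ≠ 1 := by decide
    simp [hX, h, h', ite_mul]
  suffices key : ∀ w, M *ᵥ w = 0 → w = 0 by
    intro z z' h
    exact sub_eq_zero.1 (key (z - z') (by rw [Matrix.mulVec_sub, h, sub_self]))
  intro w hw
  set σ := finRotate n
  have row : ∀ (T : PSub (2 * 1 + 1) (1 + 1)) (ν : Fin n),
      ∑ j ∈ T.1, (koszulSign (T.1.erase j) j : K) *
        ∑ κ, X j (κ, ν) * extendPSub w (T.1.erase j) κ = 0 := by
    intro T ν
    have := congrFun hw (T, ν)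
    rw [matMulKoszulMatrix_mulVec] at this
    simpa only [hsingle, Pi.zero_apply] using this
  have h01 : ∀ ν, extendPSub w {1} ν = extendPSub w {0} (σ.symm ν) := by
    intro ν
    have := row ⟨{0, 1}, by decide⟩ ν
    dsimp only at this
    have e0 : (({0, 1} : Finset (Fin (2 * 1 + 1))).erase 0) = {1} := by decide
    have e1 : (({0, 1} : Finset (Fin (2 * 1 + 1))).erase 1) = {0} := by decide
    have s0 : koszulSign ({1} : Finset (Fin (2 * 1 + 1))) 0 = 1 := by decide
    have s1 : koszulSign ({0} : Finset (Fin (2 * 1 + 1))) 1 = -1 := by decide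
    rw [Finset.sum_pair (by decide), e0, e1, s0, s1, sum0, sum1] at this
    push_cast at this
    linear_combination this
  have h02 : ∀ ν, extendPSub w {2} ν = d ν * extendPSub w {0} ν := by
    intro ν
    have := row ⟨{0, 2}, by decide⟩ ν
    dsimp only at this
    have e0 : (({0, 2} : Finset (Fin (2 * 1 + 1))).erase 0) = {2} := by decide
    have e1 : (({0, 2} : Finset (Fin (2 * 1 + 1))).erase 2) = {0} := by decide
    have s0 : koszulSign ({2} : Finset (Fin (2 * 1 + 1))) 0 = 1 := by decide
    have s1 : koszulSign ({0} : Finset (Fin (2 * 1 + 1))) 2 = -1 := by decide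
    rw [Finset.sum_pair (by decide), e0, e1, s0, s1, sum0, sum2] at this
    push_cast at this
    linear_combination this
  have h12 : ∀ ν, extendPSub w {2} (σ.symm ν) = d ν * extendPSub w {1} ν := by
    intro ν
    have := row ⟨{1, 2}, by decide⟩ ν
    dsimp only at this
    have e0 : (({1, 2} : Finset (Fin (2 * 1 + 1))).erase 1) = {2} := by decide
    have e1 : (({1, 2} : Finset (Fin (2 * 1 + 1))).erase 2) = {1} := by decide
    have s0 : koszulSign ({2} : Finset (Fin (2 * 1 + 1))) 1 = 1 := by decide
    have s1 : koszulSign ({1} : Finset (Fin (2 * 1 + 1))) 2 = -1 := by decide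
    rw [Finset.sum_pair (by decide), e0, e1, s0, s1, sum1, sum2] at this
    push_cast at this
    linear_combination this
  have hw0 : ∀ κ, extendPSub w {0} κ = 0 := by
    intro κ
    have hne : σ κ ≠ κ := finRotate_apply_ne hn κ
    have e1 := h01 (σ κ)
    have e2 := h02 κ
    have e3 := h12 (σ κ)
    rw [Equiv.symm_apply_apply] at e1 e3
    have h : (d (σ κ) - d κ) * extendPSub w {0} κ = 0 := by
      linear_combination e2 - e3 - d (σ κ) * e1
    rcases mul_eq_zero.1 h with h | h
    · exact absurd (hd (sub_eq_zero.1 h)) hne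
    · exact h
  have hw1 : ∀ ν, extendPSub w {1} ν = 0 := fun ν => by rw [h01, hw0]
  have hw2 : ∀ ν, extendPSub w {2} ν = 0 := fun ν => by rw [h02, hw0, mul_zero]
  funext ⟨S, κ⟩
  obtain ⟨j, hj⟩ := Finset.card_eq_one.1 S.2
  have hS : w (S, κ) = extendPSub w {j} κ := by rw [← extendPSub_val w S κ, hj]
  rw [Pi.zero_apply, hS]
  fin_cases j
  · simpa using hw0 κ
  · simpa using hw1 κ
  · simpa using hw2 κ

end POneField

/-! ## Landsberg 2014, Prop 2.1 + Lemma 2.2 + §3 over an infinite field -/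

section PropTwoOneField

/-- **Landsberg 2014, Proposition 2.1 with Lemma 2.2, applied to the reduced Koszul flattening of
`⟨n, m, n⟩` (§3), over an arbitrary infinite field `K`**: if for some `Φ : K^{n×n} → K^{2p+1}` the
reduced Koszul matrix `M̃(Φ)` of `⟨n, m, n⟩` (`m ≥ 1`) has a non-zero minor of size `ρ = |ι|`, then
`m ρ + binom(2p,p) n² ≤ binom(2p,p) (ρ + R(⟨n, m, n⟩))`.  This is `Landsberg2014_prop_2_1_koszul`
(stated there over `ℂ`, following the paper: "I work over the complex numbers throughout") with the
same proof, which uses the ground field only through Lemma 2.2, valid over any infinite integral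
domain (`Landsberg2014_lemma_2_2`): optimal decomposition, the `a_i` span `A`, a basis among them
parametrises `Φ`, the minor is a non-zero polynomial of degree `≤ ρ` in the `Φ(a_i)`, Lemma 2.2
kills all but `≤ ρ` of them, and LO2015 Thm 2.1 bounds the Koszul flattening of the surviving
`≤ ρ + r − n²` terms. [cite: Landsberg2014, Prop 2.1, Lemma 2.2 and §3] -/
theorem Landsberg2014_prop_2_1_koszul_field {K : Type*} [Field K] [Infinite K] (n m p : ℕ)
    (hm : 0 < m) (Φ : (Fin n × Fin n → K) →ₗ[K] (Fin (2 * p + 1) → K)) {ι : Type*} [Fintype ι]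
    [DecidableEq ι] (er : ι → PSub (2 * p + 1) (p + 1) × Fin n)
    (ec : ι → PSub (2 * p + 1) p × Fin n)
    (hdet : ((matMulKoszulMatrix n p Φ).submatrix er ec).det ≠ 0) :
    m * Fintype.card ι + (2 * p).choose p * n ^ 2 ≤
      (2 * p).choose p * (Fintype.card ι + tensorRank (matMulTensor K n m n)) := by
  classical
  haveI : NeZero m := ⟨hm.ne'⟩
  obtain ⟨w, u, v, ht⟩ := exists_triad_decomposition_tensorRank (matMulTensor K n m n)
  -- the `w_i` span; extract a basis `b k = w (a k)`
  have hspan : Submodule.span K (Set.range w) = ⊤ :=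
    span_eq_top_of_matMul_decomposition w u v ht
  obtain ⟨κ', a, ha, hspan', hli⟩ := exists_linearIndependent' K w
  haveI : Fintype κ' := Fintype.ofInjective a ha
  let b : Module.Basis κ' K (Fin n × Fin n → K) := Module.Basis.mk hli (by rw [hspan', hspan])
  have hb : ∀ k, b k = w (a k) := fun k => Module.Basis.mk_apply hli _ k
  have hcardκ : Fintype.card κ' = n ^ 2 := by
    have := Module.finrank_eq_card_basis b
    rw [Module.finrank_fintype_fun_eq_card, Fintype.card_prod, Fintype.card_fin] at this
    rw [← this, sq]
  have hn2r : n ^ 2 ≤ tensorRank (matMulTensor K n m n) := by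
    rw [← hcardκ, ← Fintype.card_fin (tensorRank (matMulTensor K n m n))]
    exact Fintype.card_le_of_injective a ha
  -- the generic reduced Koszul matrix, entries linear forms in `x_{k j} = Φ(b k)_j`
  let coef : κ' → Fin n → Fin n → K := fun k κ ν => b.repr (Pi.single (κ, ν) 1) k
  let eGen : Fin n → Fin n → Fin (2 * p + 1) → MvPolynomial (κ' × Fin (2 * p + 1)) K :=
    fun κ ν j => ∑ k, MvPolynomial.C (coef k κ ν) * MvPolynomial.X (k, j)
  let Mgen : Matrix (PSub (2 * p + 1) (p + 1) × Fin n) (PSub (2 * p + 1) p × Fin n)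
      (MvPolynomial (κ' × Fin (2 * p + 1)) K) :=
    Matrix.of fun r c => wedgeMatrix (eGen c.2 r.2) r.1.1 c.1.1
  let P : MvPolynomial (κ' × Fin (2 * p + 1)) K := (Mgen.submatrix er ec).det
  let Φy : (κ' × Fin (2 * p + 1) → K) → ((Fin n × Fin n → K) →ₗ[K] (Fin (2 * p + 1) → K)) :=
    fun y => b.constr K (fun k j => y (k, j))
  have hΦy_single : ∀ y κ ν j, Φy y (Pi.single (κ, ν) 1) j = ∑ k, coef k κ ν * y (k, j) := by
    intro y κ ν j
    simp only [Φy, Module.Basis.constr_apply_fintype, Module.Basis.equivFun_apply,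
      Finset.sum_apply, Pi.smul_apply, smul_eq_mul, coef]
  have heval : ∀ y, MvPolynomial.eval y P =
      ((matMulKoszulMatrix n p (Φy y)).submatrix er ec).det := by
    intro y
    simp only [P]
    rw [RingHom.map_det, RingHom.mapMatrix_apply, ← Matrix.submatrix_map]
    congr 1
    ext i i'
    simp only [Matrix.submatrix_apply, Matrix.map_apply, Mgen, Matrix.of_apply,
      matMulKoszulMatrix_apply]
    rw [wedgeMatrix_map]
    congr 1
    funext j
    simp only [Function.comp_apply, eGen, map_sum, map_mul, MvPolynomial.eval_C,
      MvPolynomial.eval_X]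
    rw [hΦy_single]
  -- `P ≠ 0` since `P(Φ) ≠ 0`
  have hP : P ≠ 0 := by
    intro h0
    apply hdet
    have hy0 := heval (fun v => Φ (b v.1) v.2)
    have hΦ : Φy (fun v => Φ (b v.1) v.2) = Φ := b.constr_self K Φ
    rw [hΦ, h0, map_zero] at hy0
    exact hy0.symm
  -- `deg P ≤ |ι|`
  have hdeg : P.totalDegree ≤ Fintype.card ι := by
    apply totalDegree_det_le
    intro i i'
    simp only [Matrix.submatrix_apply, Mgen, Matrix.of_apply, wedgeMatrix_apply]
    refine MvPolynomial.totalDegree_finsetSum_le fun j _ => ?_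
    split_ifs
    · refine (MvPolynomial.totalDegree_mul _ _).trans ?_
      have h1 : ∀ z : ℤ, ((z : MvPolynomial (κ' × Fin (2 * p + 1)) K)).totalDegree = 0 := by
        intro z
        rw [← map_intCast (MvPolynomial.C : K →+* _), MvPolynomial.totalDegree_C]
      rw [h1, zero_add]
      refine MvPolynomial.totalDegree_finsetSum_le fun k _ => ?_
      refine (MvPolynomial.totalDegree_mul _ _).trans ?_
      rw [MvPolynomial.totalDegree_C, MvPolynomial.totalDegree_X, zero_add]
    · rw [MvPolynomial.totalDegree_zero]
      exact Nat.zero_le _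
  -- Lemma 2.2: a point supported on `≤ deg P` first indices
  obtain ⟨Sset, y, hScard, hy0, hyP⟩ := Landsberg2014_lemma_2_2 P hP
  have hSι : Sset.card ≤ Fintype.card ι := hScard.trans hdeg
  have hΦ'zero : ∀ k, k ∉ Sset → Φy y (w (a k)) = 0 := by
    intro k hk
    rw [← hb k]
    simp only [Φy, Module.Basis.constr_basis]
    funext j
    exact hy0 (k, j) hk
  have hdet' : ((matMulKoszulMatrix n p (Φy y)).submatrix er ec).det ≠ 0 := by
    rw [← heval]; exact hyP
  -- lower bound: `K_{Φ'}(⟨n,m,n⟩) ⊇ M̃(Φ')|_{minor} ⊗ Id_m`, invertible of size `m |ι|`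
  have hlow : m * Fintype.card ι ≤ (koszulFlattening p (Φy y) (matMulTensor K n m n)).rank := by
    have hsub := koszulFlattening_matMul_submatrix n m p (Φy y) er ec
    have hunit : IsUnit ((koszulFlattening p (Φy y) (matMulTensor K n m n)).submatrix
        (fun x : ι × Fin m => ((er x.1).1, (x.2, (er x.1).2)))
        (fun x : ι × Fin m => ((ec x.1).1, ((ec x.1).2, x.2)))) := by
      rw [Matrix.isUnit_iff_isUnit_det, hsub, Matrix.det_blockDiagonal, Finset.prod_const]
      exact IsUnit.pow _ (isUnit_iff_ne_zero.2 hdet')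
    calc m * Fintype.card ι = Fintype.card (ι × Fin m) := by simp [mul_comm]
      _ = ((koszulFlattening p (Φy y) (matMulTensor K n m n)).submatrix
        (fun x : ι × Fin m => ((er x.1).1, (x.2, (er x.1).2)))
        (fun x : ι × Fin m => ((ec x.1).1, ((ec x.1).2, x.2)))).rank :=
          (Matrix.rank_of_isUnit _ hunit).symm
      _ ≤ _ := Matrix.rank_submatrix_le _ _ _
  -- upper bound: only the terms `l ∉ a(κ' ∖ Sset)` survive
  let Lset : Finset (Fin (tensorRank (matMulTensor K n m n))) :=
    Finset.univ.filter fun l => ∀ k, a k = l → k ∈ Sset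
  have hK : koszulFlattening p (Φy y) (matMulTensor K n m n) =
      koszulFlattening p (Φy y) (∑ l ∈ Lset, triad (w l) (u l) (v l)) := by
    have ht' : matMulTensor K n m n = (∑ l ∈ Lset, triad (w l) (u l) (v l)) +
        ∑ l ∈ Finset.univ.filter (fun l => ¬ ∀ k, a k = l → k ∈ Sset),
          triad (w l) (u l) (v l) := by
      rw [Finset.sum_filter_add_sum_filter_not]; exact ht
    have hzero : ∑ l ∈ Finset.univ.filter (fun l => ¬ ∀ k, a k = l → k ∈ Sset),
        koszulFlattening p (Φy y) (triad (w l) (u l) (v l)) = 0 := by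
      refine Finset.sum_eq_zero fun l hl => ?_
      obtain ⟨k, hk, hkS⟩ : ∃ k, a k = l ∧ k ∉ Sset := by
        have := (Finset.mem_filter.1 hl).2
        push Not at this
        exact this
      apply koszulFlattening_triad_of_map_eq_zero
      rw [← hk]
      exact hΦ'zero k hkS
    rw [congrArg (koszulFlattening p (Φy y)) ht', koszulFlattening_add,
      koszulFlattening_sum p (Φy y) (Finset.univ.filter (fun l => ¬ ∀ k, a k = l → k ∈ Sset)),
      hzero, add_zero]
  have hrank_t' : (koszulFlattening p (Φy y) (∑ l ∈ Lset, triad (w l) (u l) (v l))).rank ≤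
      (2 * p).choose p * Lset.card := by
    have h1 := LandsbergOttaviani2015_rank_koszulFlattening_le p (Φy y)
      (∑ l ∈ Lset, triad (w l) (u l) (v l))
    have h2 : tensorRank (∑ l ∈ Lset, triad (w l) (u l) (v l)) ≤ Lset.card := by
      have := tensorRank_le_card_of_eq_sum (t := ∑ l ∈ Lset, triad (w l) (u l) (v l))
        (fun l : Lset => w l) (fun l => u l) (fun l => v l) (by rw [← Finset.sum_coe_sort])
      simpa using this
    exact h1.trans (Nat.mul_le_mul_left _ h2)
  have hLcard : Lset.card ≤ (tensorRank (matMulTensor K n m n) - n ^ 2) + Sset.card := by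
    have hsub : Lset ⊆ (Finset.univ \ Finset.univ.image a) ∪ Sset.image a := by
      intro l hl
      have hl' := (Finset.mem_filter.1 hl).2
      by_cases h : ∃ k, a k = l
      · obtain ⟨k, rfl⟩ := h
        exact Finset.mem_union_right _ (Finset.mem_image_of_mem a (hl' k rfl))
      · push Not at h
        apply Finset.mem_union_left
        simp only [Finset.mem_sdiff, Finset.mem_univ, Finset.mem_image, true_and, not_exists]
        exact h
    have hcimg : (Finset.univ.image a : Finset (Fin (tensorRank (matMulTensor K n m n)))).card =
        n ^ 2 := by
      rw [Finset.card_image_of_injective _ ha, Finset.card_univ, hcardκ]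
    calc Lset.card ≤ ((Finset.univ \ Finset.univ.image a) ∪ Sset.image a).card :=
          Finset.card_le_card hsub
      _ ≤ (Finset.univ \ Finset.univ.image a).card + (Sset.image a).card :=
          Finset.card_union_le _ _
      _ = (tensorRank (matMulTensor K n m n) - n ^ 2) + Sset.card := by
          rw [Finset.card_univ_sdiff, hcimg, Fintype.card_fin,
            Finset.card_image_of_injective _ ha]
  -- combine
  have hfin : m * Fintype.card ι ≤
      (2 * p).choose p * ((tensorRank (matMulTensor K n m n) - n ^ 2) + Fintype.card ι) := by
    refine hlow.trans ?_
    rw [hK]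
    exact hrank_t'.trans (Nat.mul_le_mul_left _ (hLcard.trans (Nat.add_le_add_left hSι _)))
  have e : (tensorRank (matMulTensor K n m n) - n ^ 2) + Fintype.card ι + n ^ 2 =
      Fintype.card ι + tensorRank (matMulTensor K n m n) := by omega
  calc m * Fintype.card ι + (2 * p).choose p * n ^ 2
      ≤ (2 * p).choose p * ((tensorRank (matMulTensor K n m n) - n ^ 2) + Fintype.card ι) +
          (2 * p).choose p * n ^ 2 := Nat.add_le_add_right hfin _
    _ = (2 * p).choose p * (Fintype.card ι + tensorRank (matMulTensor K n m n)) := by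
        rw [← Nat.mul_add, e]

end PropTwoOneField

/-! ## Bläser 1999, Theorem 2 -/

/-- **The bound over an infinite field**: for an infinite field `K` and every `n`,
`(5/2) n² − 3n ≤ R(⟨n,n,n⟩_K)`.  For `n ≤ 1` this is below the flattening bound `n² ≤ R`; for
`n ≥ 2` pick pairwise distinct `d₀, …, d_{n−1} ∈ K` (`K` is infinite), apply
`Landsberg2014_prop_2_1_koszul_field` with `p = 1`, `m = n` to the full `3n × 3n` minor of `M̃` for
the projection `Id`/cyclic shift/`diag(d)` (`exists_matMulKoszulMatrix_one_injective`):
`3n·n + 2n² ≤ 2(3n + R)`, i.e. `R ≥ (5/2) n² − 3n` (Landsberg 2014, Thm 1.2 with `p = 1`; Bläser's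
Thm 2 is proved in the source for infinite `k` first, §5). [cite: Blaser1999, Thm 2 (case k infinite, §5)] -/
theorem Blaser1999_rank_lower_bound_of_infinite (K : Type*) [Field K] [Infinite K] (n : ℕ) :
    (5 / 2 : ℝ) * (n : ℝ) ^ 2 - 3 * n ≤ (tensorRank (matMulTensor K n n n) : ℝ) := by
  have hsq : ((n : ℝ)) ^ 2 ≤ (tensorRank (matMulTensor K n n n) : ℝ) := by
    exact_mod_cast matMulTensor_sq_le_tensorRank K n
  have hn0 : (0 : ℝ) ≤ n := Nat.cast_nonneg n
  rcases lt_or_ge n 2 with hn2 | hn2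
  · -- `n ≤ 1`: below the flattening bound
    have hn1 : (n : ℝ) ≤ 1 := by exact_mod_cast Nat.lt_succ_iff.1 hn2
    nlinarith [hsq, hn0, hn1, mul_nonneg hn0 (sub_nonneg.2 hn1)]
  · -- `n ≥ 2`: the diagonal/cyclic-shift projection, `ρ = 3n`
    let d : Fin n → K := fun i => Infinite.natEmbedding K i
    have hd : Function.Injective d := fun i j h => Fin.ext (by simpa [d] using h)
    obtain ⟨Φ, hΦ⟩ := exists_matMulKoszulMatrix_one_injective K n hn2 d hd
    obtain ⟨ε, hε⟩ := exists_det_submatrix_ne_zero_of_injective (matMulKoszulMatrix n 1 Φ)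
      (by simp [Fintype.card_prod]) hΦ
    have key := Landsberg2014_prop_2_1_koszul_field n n 1 (by omega) Φ
      (ι := PSub (2 * 1 + 1) (1 + 1) × Fin n) id ε (by simpa using hε)
    have hcard : Fintype.card (PSub (2 * 1 + 1) (1 + 1) × Fin n) = 3 * n := by
      simp [Fintype.card_prod]
    have hc : (2 * 1).choose 1 = 2 := by decide
    rw [hcard, hc] at key
    have key' : (n : ℝ) * (3 * n) + 2 * (n : ℝ) ^ 2 ≤
        2 * (3 * n + (tensorRank (matMulTensor K n n n) : ℝ)) := by
      exact_mod_cast key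
    nlinarith [key']

/-- **Bläser 1999, Theorem 2** (discharge of `Blaser1999_rank_lower_bound`): for every field `K`
and every `n`, `R(⟨n,n,n⟩_K) ≥ (5/2) n² − 3n`.  As in the source (§5, (10)): the rank can only drop
under extension of scalars, `R_{K̄}(⟨n,n,n⟩) ≤ R_K(⟨n,n,n⟩)` (`tensorRank_matMulTensor_map_le`), and
the algebraic closure `K̄` is infinite, where `Blaser1999_rank_lower_bound_of_infinite` applies.
[cite: Blaser1999, Thm 2] -/
theorem Blaser1999_rank_lower_bound_holds : Blaser1999_rank_lower_bound := by
  intro K _ n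
  calc (5 / 2 : ℝ) * (n : ℝ) ^ 2 - 3 * n
      ≤ (tensorRank (matMulTensor (AlgebraicClosure K) n n n) : ℝ) :=
        Blaser1999_rank_lower_bound_of_infinite (AlgebraicClosure K) n
    _ ≤ (tensorRank (matMulTensor K n n n) : ℝ) := by
        exact_mod_cast tensorRank_matMulTensor_map_le (algebraMap K (AlgebraicClosure K)) n n n

end Literature.Computability.AlgebraicComplexity

end
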